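import Mathlib.AlgebraicGeometry.Properties
import Mathlib.Algebra.CharP.Basic
import Mathlib.Algebra.CharP.Lemmas
import HarnessLib

/-!
# Characteristic `p` of the sections of an integral scheme over a characteristic-`p` base

Support file for crux stmt-ResolutionOfSingularities-15315
(`FrobeniusLadder.FInjectiveMacaulayfication`, line `Sketch`, seat c6): stub
`stub_charP_sections`.

The tower step of the F-injective Macaulayfication line needs `char Γ(X, V) = p` for every
non-empty affine open `V` of an integral intermediate model `X` mapping to a base `Y` whose ring
of global sections `Γ(Y, ⊤)` has characteristic `p` (e.g. `Y = Spec R` with `char R = p`).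

Proof: the composite ring map `Γ(Y, ⊤) → Γ(X, ⊤) → Γ(X, V)` (pull back along `g`, then restrict)
sends `(p : Γ(Y, ⊤)) = 0` to `(p : Γ(X, V))`, so `(p : Γ(X, V)) = 0`. Since `X` is integral and
`V` is non-empty, `Γ(X, V)` is a domain, in particular non-trivial, and for a prime `p` the
vanishing `(p : A) = 0` in a non-trivial ring `A` is equivalent to `CharP A p`
(`CharP.charP_iff_prime_eq_zero`).

References: folklore bookkeeping over Mathlib's `CharP` and `AlgebraicGeometry.IsIntegral` API;
no definition is declared. [folklore]
-/

-- single-problem summit: the doubled namespace component `ResolutionOfSingularities` is forced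
set_option linter.dupNamespace false

noncomputable section

namespace Summit.ResolutionOfSingularities.ResolutionOfSingularities.Theorems.FInjectiveMacaulayfication.CharPSections

open AlgebraicGeometry CategoryTheory

/-- If a scheme `X` maps to a scheme `Y` whose global sections have `(p : Γ(Y, ⊤)) = 0`, then
`(p : Γ(X, V)) = 0` for every open `V` of `X`: push the identity along the composite ring map
`Γ(Y, ⊤) → Γ(X, ⊤) → Γ(X, V)`. [folklore] -/
theorem natCast_sections_eq_zero {X Y : Scheme.{0}} (g : X ⟶ Y) (p : ℕ)
    (h : (p : Γ(Y, ⊤)) = 0) (V : X.Opens) : (p : Γ(X, V)) = 0 := by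
  have h' := congrArg ((X.presheaf.map (homOfLE (le_top : V ≤ ⊤)).op).hom.comp g.appTop.hom) h
  rwa [map_natCast, map_zero] at h'

/-- **Characteristic `p` on non-empty affine opens.** Let `p` be a prime, `X` an integral scheme
with a morphism `g : X ⟶ Y`, and suppose the global sections `Γ(Y, ⊤)` of `Y` have
characteristic `p`. Then for every non-empty affine open `V` of `X` the domain `Γ(X, V)` has
characteristic `p`. [folklore] -/
theorem stub_charP_sections : ∀ (p : ℕ) [Fact p.Prime] (X Y : Scheme.{0}) [IsIntegral X] (g : X ⟶ Y),
    CharP Γ(Y, ⊤) p → ∀ V : X.affineOpens, ((V : X.Opens) : Set X).Nonempty → CharP Γ(X, V) p := by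
  intro p _ X Y _ g hY V hV
  obtain ⟨x, hx⟩ := hV
  haveI : Nonempty (V : X.Opens) := ⟨⟨x, hx⟩⟩
  haveI : IsDomain Γ(X, V) := IsIntegral.component_integral (V : X.Opens)
  exact (CharP.charP_iff_prime_eq_zero Fact.out).2
    (natCast_sections_eq_zero g p (CharP.cast_eq_zero Γ(Y, ⊤) p) V)

end Summit.ResolutionOfSingularities.ResolutionOfSingularities.Theorems.FInjectiveMacaulayfication.CharPSections

end
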